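import Summits.BirchSwinnertonDyer.BirchSwinnertonDyer.Theses.SemiOrdinaryEisensteinDescent
import Summits.BirchSwinnertonDyer.BirchSwinnertonDyer.Theorems.KolyvaginRoadThreeLevelData
import Literature.NumberTheory.EllipticCurves.HeegnerPointsOfConductorRationalityProofs
import Literature.NumberTheory.EllipticCurves.RingClassGalOverCyclicProofs
import Literature.NumberTheory.EllipticCurves.BoxerDiao2010.TamagawaTwistHolds
import Literature.NumberTheory.EllipticCurves.TamagawaFiniteIndexProofs
import Literature.NumberTheory.EllipticCurves.ModularParametrizationDegreeProofs
import Literature.NumberTheory.EllipticCurves.ModularCurveManinConstantProofs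
import Literature.NumberTheory.EllipticCurves.ModularParametrization

/-!
# Negative-lane lemmas for crux J‴ `SemiOrdinaryEisensteinDescent.WildSigmaDivisibilityAtThreeMultiCarrier`
# (stmt-BirchSwinnertonDyer-25898): (A) the multi-carrier FRAME cut is cosmetic under up-scaling of the datum;
# (B) the innermost binder is never vacuous and the LEVEL-ONE layer is the Σ-form Tamagawa–Manin divisibility of `y_K`

Refuter vet files (Negative lane, `--supports` stmt-BirchSwinnertonDyer-25898; nothing here refutes the crux, which stays OPEN
research — Jetchev 2008 Conj. 1.3 «≥» beyond the max at the additive prime `3` = Büyükboduk 2009 §4.2 Q1 ⊕ Manin₃; and nothing here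
asserts any route statement positively). Part (A) is vet tk5j gen 0 (2026-08-28, proposal p610488 bounced only on a transient farm
probe + the theses-cone advisory; re-filed here WITHOUT the cone import: the scaling identities `φ_B = 3·φ`, `y_n(B) = 3·y_n`, `P_B(n) = 3·P(n)` of the lead's
`…WildSigmaDivisibilityAtThreeOfFlatOfManinScaling` §§1–2 are re-derived as local steps of the one proof that uses them), part (B) is
vet tk5j gen 2.

J‴ restricts J′ (`WildSigmaDivisibilityAtThreeTowerFree`, 24702) to frames on which no single local Tamagawa number carries the depth
`t = ord₃ ∏ c_q + v₃ c(Dt)` (`∀ q ∣ N, ord₃ c_q < t`). Sorry-free, standard axioms: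

(A) DATUM SCALING
* `exists_scaled_datum`: every parametrisation datum `Dt` and every `k ≠ 0` admit a datum `B` with the SAME newform and uniformisation
  and `c(B) = k · c(Dt)` (geometrically `[k]∘φ`; degree from the tree's `exists_modularDegree_holds`, transported along `ℂ/Λ_E ≃ E(ℂ)`).
* `sigmaAllFramesSlackOne_of_wildSigmaDivisibilityAtThreeMultiCarrier`: **J‴ ⟹ J′ on EVERY frame with ONE Kolyvagin index of slack**
  (index clause `s′ + 1 ≤ M(ℓ)` instead of `s′ ≤ M(ℓ)`), the no-`3`-torsion of `E(K[n])` displayed as a binder (Gross 1991 Lemma 4.3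
  under `ρ̄₃` onto). Mechanism: on `B = [3]∘φ` the depth is `t + 1` while `ord₃ c_q ≤ ord₃ ∏ c_ℓ ≤ t` for every `q`, so `B`'s frame is
  multi-carrier WHATEVER `Dt`'s frame was; the Kolyvagin datum up-scales (`y ↦ 3y`, same `σ_ℓ`, `S`, embedding; `P_B(n) = 3 P(n)`), and
  J‴ at depth `s′ + 1` gives `3^{s′+1} ∣ 3 P(n)`, i.e. `3^{s′} ∣ P(n)`.
* `localDepthSlackOne_of_wildSigmaDivisibilityAtThreeMultiCarrier`: hence J‴ alone re-delivers the inner Jetchev max-form depths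
  `s′ ≤ ord₃ c_q` (the content split off into item 25897) with index slack one.
Reading: `J′ ⟹ J‴ ⟹ J′[slack 1]` — the frame restriction relieves J′ of nothing but the sharp index boundary `s′ = M(ℓ)`; the
scaling-INVARIANT research residue is the FLAT one (`¬ 3 ∣ c(Dt)`, `stub_flatMultiCarrier` of the registered line) ⊕ Manin₃.

(B) NON-VACUITY AND THE LEVEL-ONE LAYER
* `nonempty_kolyvaginHeegnerData_of_frame`: on every frame of J‴ (K imaginary quadratic, Heegner for `N`) the datum type
  `KolyvaginHeegnerData Dt H.β ι n` is INHABITED at every square-free `n` with Kolyvagin prime factors — Gross 1991 §3 rationality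
  (`phi_heegnerPointOfConductor_mem_range_map_ringClassField_holds`, PROVED in the tree) + cyclicity of `G_ℓ`
  (`exists_generator_ringClassGalOver_holds`) through `nonempty_kolyvaginHeegnerData_of_grossCM`; so J‴'s `∀ d` is never vacuous and
  `exists_pDiv_of_wildSigmaDivisibilityAtThreeMultiCarrier` is its honest ∃-form level by level.
* `levelOne_of_wildSigmaDivisibilityAtThreeMultiCarrier` / `exists_levelOne_…`: at `n = 1` (no Kolyvagin prime, empty index clause),
  `s′ = t`: **J‴ ⟹ the basic Heegner point `P(1) = Tr_{K[1]/K} y(1)` (= `y_K` in `E(K[1])`) is `3^t`-divisible in `E(K[1])` on every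
  multi-carrier frame** — the Σ-form (PRODUCT) Tamagawa–Manin divisibility of the Heegner point. For ≥ 2 Tamagawa carriers this first
  layer is already beyond print (Jetchev 2008 Thm. 1.4 / Cor. 1.5 give `max_q ord₃ c_q`, under `p ∤ N`; the product is his Conj. 1.3,
  predicted by Gross–Zagier + BSD(E/K): `[E(K) : ℤ y_K] = c · u_K · ∏_{q∣N} c_q · √#Ш(E/K)`).
BSD is not proved by anything here. [folklore]
-/

-- single-conjunct summit: `Summit.BirchSwinnertonDyer.BirchSwinnertonDyer.…` repeats the name by design (tree layout D-0017,
-- as in the accepted siblings `AdditiveKolyvaginRoadLevelRealisation`, `…OfFlatOfManinScaling`)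
set_option linter.dupNamespace false

noncomputable section

open scoped Classical UpperHalfPlane

namespace Summit.BirchSwinnertonDyer.BirchSwinnertonDyer.Theorems.WildSigmaDivisibilityAtThreeMultiCarrier.Negative

open WeierstrassCurve NumberField
  Literature.NumberTheory.EllipticCurves
  Literature.NumberTheory.EllipticCurves.ModularForms
  Summit.BirchSwinnertonDyer.Rank1Residual
  Summit.BirchSwinnertonDyer.Rank1Residual.Additive
  Summit.BirchSwinnertonDyer.Rank1Residual.X11b
  Summit.BirchSwinnertonDyer.Rank1Residual.X11b.Three
  Summit.BirchSwinnertonDyer.BirchSwinnertonDyer.Theses.SemiOrdinaryEisensteinDescent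

/-! ## §A Datum scaling: the frame cut is cosmetic up to one Kolyvagin index (vet tk5j gen 0) -/

/-- **Scaling a parametrisation datum by any non-zero integer** (`φ ↦ [k]∘φ`): same newform, Néron lattice and
uniformisation, Manin constant `k·c`; the modular degree is supplied by the tree's `exists_modularDegree_holds` and transported
along `ℂ/Λ_E ≃ E(ℂ)` exactly as in `nonempty_modularParametrizationData_of`. [folklore] -/
theorem exists_scaled_datum {W : WeierstrassCurve ℚ} {N : ℕ} [NeZero N] (Dt : ModularParametrizationData W N)
    {k : ℤ} (hk : k ≠ 0) :
    ∃ B : ModularParametrizationData W N, Dt.f = B.f ∧ Dt.uniformize = B.uniformize ∧ B.c = k * Dt.c := by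
  have hc : ∀ z ∈ periodLattice Dt.f, ((k * Dt.c : ℤ) : ℂ) * z ∈ Dt.L.lattice := by
    intro z hz
    have h1 := Dt.smul_periodLattice_le z hz
    have h2 : ((k * Dt.c : ℤ) : ℂ) * z = k • ((Dt.c : ℂ) * z) := by
      rw [zsmul_eq_mul]; push_cast; ring
    rw [h2]
    exact Dt.L.lattice.smul_mem k h1
  have hc0 : ((k * Dt.c : ℤ) : ℂ) ≠ 0 :=
    Int.cast_ne_zero.mpr (mul_ne_zero hk Dt.maninConstant_ne_zero_holds)
  obtain ⟨d, hd, hfin⟩ := exists_modularDegree_holds Dt.isNewformOf.1.ne_zero (L := Dt.L)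
    (c := ((k * Dt.c : ℤ) : ℂ)) hc0 hc
  have hker' : Dt.L.lattice.toAddSubgroup = Dt.uniformize.ker :=
    SetLike.coe_injective (by rw [Submodule.coe_toAddSubgroup, Dt.ker_uniformize])
  let e : ℂ ⧸ Dt.L.lattice.toAddSubgroup ≃+ (W.baseChange ℂ).toAffine.Point :=
    QuotientAddGroup.liftEquiv Dt.L.lattice.toAddSubgroup Dt.uniformize_surjective hker'
  have he : ∀ x : ℂ, e.toEquiv (x : ℂ ⧸ Dt.L.lattice.toAddSubgroup) = Dt.uniformize x := fun _ ↦ rfl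
  have key := (finite_setOf_card_fiberOrbits_ne_iff e.toEquiv
    (fun τ : ℍ ↦ ((((k * Dt.c : ℤ) : ℂ) * eichlerIntegral Dt.f τ : ℂ) : ℂ ⧸ Dt.L.lattice.toAddSubgroup)) d).mpr hfin
  simp only [he] at key
  exact ⟨{ f := Dt.f
           isNewformOf := Dt.isNewformOf
           L := Dt.L
           isNeronLattice := Dt.isNeronLattice
           uniformize := Dt.uniformize
           ker_uniformize := Dt.ker_uniformize
           uniformize_surjective := Dt.uniformize_surjective
           uniformize_spec := Dt.uniformize_spec
           c := k * Dt.c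
           smul_periodLattice_le := hc
           deg := d
           deg_pos := hd
           deg_spec := key }, rfl, rfl, rfl⟩

/-- local Tamagawa valuation ≤ global: `ord₃ c_q(E) ≤ ord₃ ∏_ℓ c_ℓ(E)` (Boxer–Diao bridge of the tree). [folklore] -/
theorem padicValNat_localTamagawa_le_tamagawaProduct (W : WeierstrassCurve ℚ) [W.IsElliptic] (q : ℕ) [Fact q.Prime] :
    padicValNat 3 ((W.baseChange ℚ_[q]).localTamagawaNumber ℤ_[q]) ≤ padicValNat 3 W.tamagawaProduct := by
  haveI : Fact (Nat.Prime 3) := ⟨Nat.prime_three⟩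
  exact (padicValNat_dvd_iff_le (W.tamagawaProduct_pos').ne').mp
    (pow_padicValNat_dvd.trans (BoxerDiao2010.localTamagawaNumber_padic_dvd_tamagawaProduct W q))

/-- **J‴ ⟹ J′ on EVERY frame with one Kolyvagin index of slack.** The conclusion is J′'s text (24702) without any frame
restriction, with the index clause `s′ + 1 ≤ M(ℓ)` and the no-`3`-torsion of `E(K[n])` displayed as a binder. Proof: up-scale the
datum (`exists_scaled_datum`, `k = 3`): on `B` the Heegner point is `3P` (non-torsion), the depth is `t + 1`
(`c(Dt) ≠ 0` by `maninConstant_ne_zero_holds`), every `q ∣ N` has `ord₃ c_q ≤ ord₃ ∏ c_ℓ < t + 1` (multi-carrier), the Kolyvagin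
datum up-scales field by field (`y ↦ 3y`) with derived point `3 P(n)`, and J‴ at depth `s′ + 1` gives
`3^{s′+1} Q = 3 P(n)`, whence `3^{s′} Q = P(n)` by the torsion binder. [folklore] -/
theorem sigmaAllFramesSlackOne_of_wildSigmaDivisibilityAtThreeMultiCarrier
    (hJ : WildSigmaDivisibilityAtThreeMultiCarrier) :
    ∀ (W : WeierstrassCurve ℚ) [W.IsElliptic] [W.IsGloballyMinimal] (N : ℕ) [NeZero N] (K : Type)
    [Field K] [NumberField K] (Dt : ModularParametrizationData W N)
    (H : HeegnerDatum N (NumberField.discr K)) (ι : K →+* ℂ) (P : (W.baseChange K).toAffine.Point),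
    ClassO6 W 3 → W.HasSurjectiveModNGaloisRep 3 → W.analyticRank = 1 → W.conductorNorm ℤ = N →
    IsImaginaryQuadratic K → SatisfiesHeegnerHypothesis N K →
    (W.quadraticTwist (NumberField.discr K : ℚ)).entireLFunction 1 ≠ 0 →
    WeierstrassCurve.Affine.Point.map ι.toRatAlgHom P = heegnerPointComplex Dt H →
    ¬ IsOfFinAddOrder P → Odd (NumberField.discr K) → NumberField.discr K ≠ -3 →
    ∀ (s' : ℕ), s' ≤ padicValNat 3 W.tamagawaProduct + padicValNat 3 Dt.c.natAbs →
      ∀ (n : ℕ) (d : KolyvaginHeegnerData Dt H.β ι n),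
        (∀ Q : (W.baseChange (ringClassField K ι n)).toAffine.Point, (3 : ℤ) • Q = 0 → Q = 0) →
        Squarefree n →
        (∀ ℓ ∈ n.primeFactors, Zhang2014.IsKolyvaginPrime N W K 3 ℓ ∧
          s' + 1 ≤ Zhang2014.kolyvaginIndex W 3 ℓ) → Koly.PDiv d 3 s' := by
  intro W _ _ N _ K _ _ Dt H ι P hO6 hsurj hr hN hK hHH hL hP hnt hodd h3 s' hs' n d hT hn hℓ
  haveI : Fact (Nat.Prime 3) := ⟨Nat.prime_three⟩
  obtain ⟨B, hf, hu, hc⟩ := exists_scaled_datum Dt three_ne_zero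
  -- analytic scaling `φ_B = 3·φ_{Dt}` on `ℍ`, hence on the traced Heegner point and on the CM points of every conductor
  have hφ : ∀ τ : UpperHalfPlane, B.φ τ = (3 : ℤ) • Dt.φ τ := fun τ ↦ by
    unfold ModularParametrizationData.φ
    rw [hu, hf, hc, Int.cast_mul, mul_assoc, ← zsmul_eq_mul, map_zsmul]
  have hHP : heegnerPointComplex B H = (3 : ℤ) • heegnerPointComplex Dt H := by
    unfold heegnerPointComplex
    rw [Finset.smul_sum]
    exact Finset.sum_congr rfl fun Q _ ↦ hφ _
  have hHPn : ∀ (D β : ℤ) (m : ℕ),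
      heegnerPointComplexOfConductor B D β m = (3 : ℤ) • heegnerPointComplexOfConductor Dt D β m :=
    fun D β m ↦ by
      unfold heegnerPointComplexOfConductor
      exact hφ _
  -- Kolyvagin's derivative is `ℤ`-linear: `P_{σ,S,n}(3·y) = 3·P_{σ,S,n}(y)`
  have hDer : ∀ y : (W.baseChange (ringClassField K ι n)).toAffine.Point,
      KolyvaginOperator.derivedPoint (pointGalHom W (ringClassField K ι n)) d.σ n d.S ((3 : ℤ) • y) =
        (3 : ℤ) • KolyvaginOperator.derivedPoint (pointGalHom W (ringClassField K ι n)) d.σ n d.S y := by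
    intro y
    have hprod : ∀ (L : List ℕ) (z : (W.baseChange (ringClassField K ι n)).toAffine.Point),
        KolyvaginOperator.derivOpProd (pointGalHom W (ringClassField K ι n)) d.σ L ((3 : ℤ) • z) =
          (3 : ℤ) • KolyvaginOperator.derivOpProd (pointGalHom W (ringClassField K ι n)) d.σ L z := by
      intro L
      induction L with
      | nil => intro z; rfl
      | cons ℓ L ih =>
        intro z
        rw [KolyvaginOperator.derivOpProd_cons, KolyvaginOperator.derivOpProd_cons, ih]
        unfold KolyvaginOperator.derivOp
        rw [Finset.smul_sum]
        exact Finset.sum_congr rfl fun i _ ↦ by rw [map_zsmul, smul_comm]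
    unfold KolyvaginOperator.derivedPoint
    rw [Finset.smul_sum]
    exact Finset.sum_congr rfl fun s _ ↦ by rw [hprod, map_zsmul]
  -- depth of `B` is `t + 1`
  have hc0 : Dt.c ≠ 0 := Dt.maninConstant_ne_zero_holds
  have hBabs : B.c.natAbs = 3 * Dt.c.natAbs := by rw [hc, Int.natAbs_mul]; rfl
  have hvB : padicValNat 3 B.c.natAbs = padicValNat 3 Dt.c.natAbs + 1 := by
    rw [hBabs, padicValNat.mul (by norm_num) (Int.natAbs_ne_zero.mpr hc0), padicValNat_self, add_comm]
  -- the frame of `B`: Heegner point `3P`, non-torsion, MULTI-CARRIER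
  have hPB : WeierstrassCurve.Affine.Point.map ι.toRatAlgHom ((3 : ℤ) • P) = heegnerPointComplex B H := by
    rw [map_zsmul, hP, hHP]
  have hntB : ¬ IsOfFinAddOrder ((3 : ℤ) • P) := fun h ↦ by
    obtain ⟨m, hm0, hm⟩ := isOfFinAddOrder_iff_zsmul_eq_zero.mp h
    exact hnt (isOfFinAddOrder_iff_zsmul_eq_zero.mpr
      ⟨m * 3, mul_ne_zero hm0 (by norm_num), by rw [mul_smul, hm]⟩)
  have hmB : ∀ (q : ℕ) [Fact q.Prime], q ∣ N →
      padicValNat 3 ((W.baseChange ℚ_[q]).localTamagawaNumber ℤ_[q]) <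
        padicValNat 3 W.tamagawaProduct + padicValNat 3 B.c.natAbs := by
    intro q _ _
    have hle := padicValNat_localTamagawa_le_tamagawaProduct W q
    rw [hvB]; omega
  have hsB : s' + 1 ≤ padicValNat 3 W.tamagawaProduct + padicValNat 3 B.c.natAbs := by rw [hvB]; omega
  -- the up-scaled Kolyvagin–Heegner datum for `B` (`y ↦ 3y`, same `σ`, `S`, embedding)
  let dB : KolyvaginHeegnerData B H.β ι n :=
    { dvd_sq_sub := d.dvd_sq_sub
      y := (3 : ℤ) • d.y
      map_y := by
        rw [map_zsmul, d.map_y, hHPn]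
      σ := d.σ
      zpowers_σ := d.zpowers_σ
      S := d.S
      S_subset := d.S_subset
      S_transversal := d.S_transversal
      emb := d.emb
      emb_apply := d.emb_apply }
  have hdB : dB.derivedPoint = (3 : ℤ) • d.derivedPoint := by
    change KolyvaginOperator.derivedPoint _ d.σ n d.S ((3 : ℤ) • d.y) =
      (3 : ℤ) • KolyvaginOperator.derivedPoint _ d.σ n d.S d.y
    exact hDer _
  -- J‴ on `B` at depth `s′ + 1`
  obtain ⟨Q', hQ'⟩ := hJ W N K B H ι ((3 : ℤ) • P) hO6 hsurj hr hN hK hHH hL hPB hntB hodd h3 hmB (s' + 1) hsB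
    n dB hn hℓ
  rw [hdB] at hQ'
  -- cancel the `3`
  refine ⟨Q', sub_eq_zero.mp (hT _ ?_)⟩
  have h33 : (3 : ℤ) * ((3 ^ s' : ℕ) : ℤ) = ((3 ^ (s' + 1) : ℕ) : ℤ) := by push_cast; ring
  rw [smul_sub, smul_smul, h33, hQ', sub_self]

/-- **Corollary.** J‴ alone re-delivers the `q`-local («Jetchev max-form», item 25897's inner content) depths `s′ ≤ ord₃ c_q`
on every frame, with one Kolyvagin index of slack and the no-`3`-torsion binder displayed — so the act-G split
J′ = (max-form) ∧ J‴ relieved J‴ of the max-form only up to that slack. [folklore] -/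
theorem localDepthSlackOne_of_wildSigmaDivisibilityAtThreeMultiCarrier
    (hJ : WildSigmaDivisibilityAtThreeMultiCarrier) :
    ∀ (W : WeierstrassCurve ℚ) [W.IsElliptic] [W.IsGloballyMinimal] (N : ℕ) [NeZero N] (K : Type)
    [Field K] [NumberField K] (Dt : ModularParametrizationData W N)
    (H : HeegnerDatum N (NumberField.discr K)) (ι : K →+* ℂ) (P : (W.baseChange K).toAffine.Point),
    ClassO6 W 3 → W.HasSurjectiveModNGaloisRep 3 → W.analyticRank = 1 → W.conductorNorm ℤ = N →
    IsImaginaryQuadratic K → SatisfiesHeegnerHypothesis N K →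
    (W.quadraticTwist (NumberField.discr K : ℚ)).entireLFunction 1 ≠ 0 →
    WeierstrassCurve.Affine.Point.map ι.toRatAlgHom P = heegnerPointComplex Dt H →
    ¬ IsOfFinAddOrder P → Odd (NumberField.discr K) → NumberField.discr K ≠ -3 →
    ∀ (q : ℕ) [Fact q.Prime], q ∣ N →
    ∀ (s' : ℕ), s' ≤ padicValNat 3 ((W.baseChange ℚ_[q]).localTamagawaNumber ℤ_[q]) →
      ∀ (n : ℕ) (d : KolyvaginHeegnerData Dt H.β ι n),
        (∀ Q : (W.baseChange (ringClassField K ι n)).toAffine.Point, (3 : ℤ) • Q = 0 → Q = 0) →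
        Squarefree n →
        (∀ ℓ ∈ n.primeFactors, Zhang2014.IsKolyvaginPrime N W K 3 ℓ ∧
          s' + 1 ≤ Zhang2014.kolyvaginIndex W 3 ℓ) → Koly.PDiv d 3 s' := by
  intro W _ _ N _ K _ _ Dt H ι P hO6 hsurj hr hN hK hHH hL hP hnt hodd h3 q _ _hqN s' hs' n d hT hn hℓ
  exact sigmaAllFramesSlackOne_of_wildSigmaDivisibilityAtThreeMultiCarrier hJ W N K Dt H ι P hO6 hsurj hr hN hK
    hHH hL hP hnt hodd h3 s'
    (hs'.trans ((padicValNat_localTamagawa_le_tamagawaProduct W q).trans (Nat.le_add_right _ _))) n d hT hn hℓ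


/-! ## §B Non-vacuity of the datum binder and the level-one layer (vet tk5j gen 2) -/

/-- **On every frame of J‴ the Kolyvagin–Heegner datum EXISTS at every square-free level with Kolyvagin prime factors**
(Kolyvagin primes are inert in `K` by definition; `β = H.β` is an orientation by `H.dvd_sq_sub`). Unconditional: Gross 1991 §3
rationality and the cyclicity of `G_ℓ` are tree theorems. [cite: GrossLMS1991, §3 (pp. 238–239) and §4 (4.1)] -/
theorem nonempty_kolyvaginHeegnerData_of_frame {W : WeierstrassCurve ℚ} [W.IsElliptic] [W.IsGloballyMinimal] {N : ℕ}
    [NeZero N] {K : Type} [Field K] [NumberField K] (Dt : ModularParametrizationData W N)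
    (H : HeegnerDatum N (NumberField.discr K)) (ι : K →+* ℂ)
    (hK : IsImaginaryQuadratic K) (hHH : SatisfiesHeegnerHypothesis N K) {n : ℕ} (hn : Squarefree n)
    (hℓ : ∀ ℓ ∈ n.primeFactors, Zhang2014.IsKolyvaginPrime N W K 3 ℓ) :
    Nonempty (KolyvaginHeegnerData Dt H.β ι n) :=
  nonempty_kolyvaginHeegnerData_of_grossCM
    (phi_heegnerPointOfConductor_mem_range_map_ringClassField_holds N W K)
    exists_generator_ringClassGalOver_holds hK hHH Dt H.β ι H.dvd_sq_sub hn
    (fun q hq ↦ (hℓ q hq).2.2.2.2.1)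

/-- **Honest ∃-form of J‴, level by level**: J‴ and `nonempty_kolyvaginHeegnerData_of_frame` give, on every multi-carrier
frame, for every depth `s′ ≤ t` and every square-free `n` with Kolyvagin prime factors of index `≥ s′`, an EXISTING datum `d`
with `3^{s′} ∣ P(n)` in `E(K[n])` (no vacuous `∀ d`). [folklore] -/
theorem exists_pDiv_of_wildSigmaDivisibilityAtThreeMultiCarrier (hJ : WildSigmaDivisibilityAtThreeMultiCarrier) :
    ∀ (W : WeierstrassCurve ℚ) [W.IsElliptic] [W.IsGloballyMinimal] (N : ℕ) [NeZero N] (K : Type)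
    [Field K] [NumberField K] (Dt : ModularParametrizationData W N)
    (H : HeegnerDatum N (NumberField.discr K)) (ι : K →+* ℂ) (P : (W.baseChange K).toAffine.Point),
    ClassO6 W 3 → W.HasSurjectiveModNGaloisRep 3 → W.analyticRank = 1 → W.conductorNorm ℤ = N →
    IsImaginaryQuadratic K → SatisfiesHeegnerHypothesis N K →
    (W.quadraticTwist (NumberField.discr K : ℚ)).entireLFunction 1 ≠ 0 →
    WeierstrassCurve.Affine.Point.map ι.toRatAlgHom P = heegnerPointComplex Dt H →
    ¬ IsOfFinAddOrder P → Odd (NumberField.discr K) → NumberField.discr K ≠ -3 →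
    (∀ (q : ℕ) [Fact q.Prime], q ∣ N →
      padicValNat 3 ((W.baseChange ℚ_[q]).localTamagawaNumber ℤ_[q]) <
        padicValNat 3 W.tamagawaProduct + padicValNat 3 Dt.c.natAbs) →
    ∀ (s' : ℕ), s' ≤ padicValNat 3 W.tamagawaProduct + padicValNat 3 Dt.c.natAbs →
    ∀ (n : ℕ), Squarefree n →
      (∀ ℓ ∈ n.primeFactors, Zhang2014.IsKolyvaginPrime N W K 3 ℓ ∧ s' ≤ Zhang2014.kolyvaginIndex W 3 ℓ) →
      ∃ d : KolyvaginHeegnerData Dt H.β ι n, Koly.PDiv d 3 s' := by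
  intro W _ _ N _ K _ _ Dt H ι P hO6 hsurj hr hN hK hHH hL hP hnt hodd h3 hm s' hs' n hn hℓ
  obtain ⟨d⟩ := nonempty_kolyvaginHeegnerData_of_frame Dt H ι hK hHH hn (fun ℓ h ↦ (hℓ ℓ h).1)
  exact ⟨d, hJ W N K Dt H ι P hO6 hsurj hr hN hK hHH hL hP hnt hodd h3 hm s' hs' n d hn hℓ⟩

/-- **The level-one layer: J‴ ⟹ the basic Heegner point `P(1)` is `3^t`-divisible in `E(K[1])` on every multi-carrier frame**
(`n = 1`: no Kolyvagin prime, `M(1) = ∞`, empty index clause; `s′ := t = ord₃ ∏ c_q + v₃ c(Dt)`). Here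
`P(1) = Σ_{s ∈ S} s·y(1) = Tr_{K[1]/K} y(1)` (`KolyvaginHeegnerData.derivedPoint_one`; `S` is all of `Gal(K[1]/K)` since `G_1` is
trivial) is the Gross–Zagier point `y_K` in `E(K[1])`. This is the Σ-form Tamagawa–Manin divisibility of the Heegner point: for
≥ 2 Tamagawa carriers at `3` beyond Jetchev 2008 Thm. 1.4 (max-form), predicted by Gross–Zagier + BSD(E/K).
[cite: Jetchev2008, Conj. 1.3 and Thm. 1.4 (p. 3)] [cite: GrossLMS1991, §4 (4.1) (P_1 = y_K)] -/
theorem levelOne_of_wildSigmaDivisibilityAtThreeMultiCarrier (hJ : WildSigmaDivisibilityAtThreeMultiCarrier) :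
    ∀ (W : WeierstrassCurve ℚ) [W.IsElliptic] [W.IsGloballyMinimal] (N : ℕ) [NeZero N] (K : Type)
    [Field K] [NumberField K] (Dt : ModularParametrizationData W N)
    (H : HeegnerDatum N (NumberField.discr K)) (ι : K →+* ℂ) (P : (W.baseChange K).toAffine.Point),
    ClassO6 W 3 → W.HasSurjectiveModNGaloisRep 3 → W.analyticRank = 1 → W.conductorNorm ℤ = N →
    IsImaginaryQuadratic K → SatisfiesHeegnerHypothesis N K →
    (W.quadraticTwist (NumberField.discr K : ℚ)).entireLFunction 1 ≠ 0 →
    WeierstrassCurve.Affine.Point.map ι.toRatAlgHom P = heegnerPointComplex Dt H →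
    ¬ IsOfFinAddOrder P → Odd (NumberField.discr K) → NumberField.discr K ≠ -3 →
    (∀ (q : ℕ) [Fact q.Prime], q ∣ N →
      padicValNat 3 ((W.baseChange ℚ_[q]).localTamagawaNumber ℤ_[q]) <
        padicValNat 3 W.tamagawaProduct + padicValNat 3 Dt.c.natAbs) →
    ∀ d : KolyvaginHeegnerData Dt H.β ι 1,
      ∃ Q : (W.baseChange (ringClassField K ι 1)).toAffine.Point,
        ((3 ^ (padicValNat 3 W.tamagawaProduct + padicValNat 3 Dt.c.natAbs) : ℕ) : ℤ) • Q =
          ∑ s ∈ d.S, pointGalHom W (ringClassField K ι 1) s d.y := by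
  intro W _ _ N _ K _ _ Dt H ι P hO6 hsurj hr hN hK hHH hL hP hnt hodd h3 hm d
  rw [← d.derivedPoint_one]
  exact hJ W N K Dt H ι P hO6 hsurj hr hN hK hHH hL hP hnt hodd h3 hm _ le_rfl 1 d squarefree_one
    (fun ℓ hℓ ↦ by simp at hℓ)

/-- **Honest ∃-form of the level-one layer**: the level-`1` datum EXISTS on every frame (`nonempty_kolyvaginHeegnerData_of_frame`),
so J‴ yields an ACTUAL `Q ∈ E(K[1])` with `3^t • Q = P(1)` on every multi-carrier frame. [folklore] -/
theorem exists_levelOne_of_wildSigmaDivisibilityAtThreeMultiCarrier (hJ : WildSigmaDivisibilityAtThreeMultiCarrier) :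
    ∀ (W : WeierstrassCurve ℚ) [W.IsElliptic] [W.IsGloballyMinimal] (N : ℕ) [NeZero N] (K : Type)
    [Field K] [NumberField K] (Dt : ModularParametrizationData W N)
    (H : HeegnerDatum N (NumberField.discr K)) (ι : K →+* ℂ) (P : (W.baseChange K).toAffine.Point),
    ClassO6 W 3 → W.HasSurjectiveModNGaloisRep 3 → W.analyticRank = 1 → W.conductorNorm ℤ = N →
    IsImaginaryQuadratic K → SatisfiesHeegnerHypothesis N K →
    (W.quadraticTwist (NumberField.discr K : ℚ)).entireLFunction 1 ≠ 0 →
    WeierstrassCurve.Affine.Point.map ι.toRatAlgHom P = heegnerPointComplex Dt H →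
    ¬ IsOfFinAddOrder P → Odd (NumberField.discr K) → NumberField.discr K ≠ -3 →
    (∀ (q : ℕ) [Fact q.Prime], q ∣ N →
      padicValNat 3 ((W.baseChange ℚ_[q]).localTamagawaNumber ℤ_[q]) <
        padicValNat 3 W.tamagawaProduct + padicValNat 3 Dt.c.natAbs) →
    ∃ d : KolyvaginHeegnerData Dt H.β ι 1, Koly.PDiv d 3 (padicValNat 3 W.tamagawaProduct + padicValNat 3 Dt.c.natAbs) := by
  intro W _ _ N _ K _ _ Dt H ι P hO6 hsurj hr hN hK hHH hL hP hnt hodd h3 hm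
  exact exists_pDiv_of_wildSigmaDivisibilityAtThreeMultiCarrier hJ W N K Dt H ι P hO6 hsurj hr hN hK hHH hL hP hnt hodd
    h3 hm _ le_rfl 1 squarefree_one (fun ℓ hℓ ↦ by simp at hℓ)

end Summit.BirchSwinnertonDyer.BirchSwinnertonDyer.Theorems.WildSigmaDivisibilityAtThreeMultiCarrier.Negative

end
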